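import Mathlib
import Literature.Probability.Percolation.UnionJack
import Literature.Probability.Percolation.SiteEmbDomainCrossing
import Literature.Probability.Percolation.QuadCrossingSquareModel
import Literature.Probability.RandomPlanarGeometry.ChordalCurveFamily
import Summits.CriticalPhenomena.CardyFormulaZ2.Theorems.UnionJackBeffaraMixedInterpolationStubCrossMonoInner
import HarnessLib

/-!
# Monotonicity of the crude crossing event under an outer bracket — stub `stub_crossMonoOuter`

Crux stmt-CriticalPhenomena-4559 `UnionJackBeffara.MixedInterpolation`, line `registered`
(skeleton `Cruxes/MixedInterpolation/Lines/birth.lean`, v5; the transfer stub T is split into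
T1–T4 and this file is T2-outer).  Deterministic, model-free Schramm–Smirnov monotonicity
("any crossing of the harder quad contains a crossing of the easier one", Ann. Probab. 39
(2011), §1.3) for the CRUDE site crossing event
`cross_δ(R) = siteEmbDomainCrossing unionJackGraph unionJackEmbed R.carrier δ (R.arc 0) (R.arc 2)`
of Beffara's centred square lattice `δ G_s` in the covering-adapted embedding.

Setting: `F` a square model of `R` (`IsSquareModel R F`), `0 < s ≤ 1/4`, `R'` an OUTER bracket:
(W1) `F(|re|<1, |im|<1-s) ⊆ R'`; (W2) `closure R'` avoids `R.arc 0 ∪ R.arc 2`; (W3) frontier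
points of `R'` in the bottom / top chart boxes belong to `R'.arc 0` / `R'.arc 2`.
Claim: eventually in `δ → 0⁺`, `cross_δ(R) ⊆ cross_δ(R')`.

Proof.  (0) `R.arc 0 ∪ R.arc 2` is compact and disjoint from the closed `closure R'`, so at
distance `≥ η₁ > 0` (`Disjoint.exists_thickenings`).  (1) `F⁻¹` is uniformly continuous on the
compact `1`-neighbourhood of `closure R`: `η₂`-close points have `s/4`-close charts.  (2) For
`δ < min (1/2, η₁/2, η₂/2)` take an open path of `δ G_s` in `R` from `u` (`2δ`-close to `R.arc 0`)
to `v` (`2δ`-close to `R.arc 2`); edges have length `≤ δ` (`dist_mesh_le`, landed T2-inner file).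
A path vertex outside `R'` has chart height `|im| ≥ 1-s` by (W1); call it BOTTOM if `im < 0`,
TOP if `im ≥ 0`, and IN if it lies in `R'`.  `u` is `2δ < η₁`-close to `R.arc 0`, hence outside
`closure R'` (W2), with chart height within `s/4` of `-1`: BOTTOM; likewise `v` is TOP.  (3) No
edge joins BOTTOM to TOP (heights `≤ -(1-s)` and `≥ 1-s` differ by `≥ 3/2 > s/4`), so a
structural induction on the walk (`outer_walk_extract`: informally `a :=` first TOP index,
`b :=` last non-IN index before `a`) yields a BOTTOM→IN edge, an open IN-path, and an IN→TOP
edge.  (4) The segment of a BOTTOM→IN edge enters the open set `R'`, so it meets `frontier R'`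
(connectedness) at a point `δ`-close to the BOTTOM end, whose chart is in the bottom box
`[-1-s, 1+s] × [-1-s, -1+3s/2]`; by (W3) it is on `R'.arc 0`, so the IN end is `2δ`-close to
`R'.arc 0`.  Idem at the top.  Hence `ω ∈ cross_δ(R')`.  No probability is involved.
-/

noncomputable section

namespace Summit.CriticalPhenomena.CardyFormulaZ2.Cruxes.MixedInterpolation.Registered

open Set Filter Topology Metric
open Literature.Probability.LatticeModels Literature.Probability.Percolation
open Literature.Probability.RandomPlanarGeometry
open Literature.Barriers.CriticalPhenomena (MixedSite mixedParam)

/-! ### Two facts of plane topology -/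

/-- A segment from a point outside an open set `U` to a point of `U` meets the frontier of `U`
(the segment is connected). [folklore] -/
theorem outer_exists_mem_frontier {U : Set ℂ} (hU : IsOpen U) {p q : ℂ} (hp : p ∉ U) (hq : q ∈ U) :
    ∃ x ∈ segment ℝ p q, x ∈ frontier U := by
  by_contra h
  push Not at h
  have hsub : segment ℝ p q ⊆ U :=
    (convex_segment p q).isPreconnected.subset_of_closure_inter_subset hU
      ⟨q, right_mem_segment ℝ p q, hq⟩ (by
        rintro x ⟨hxU, hxs⟩
        rw [closure_eq_self_union_frontier] at hxU
        exact hxU.elim id fun hx => (h x hxs hx).elim)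
  exact hp (hsub (left_mem_segment ℝ p q))

/-- A compact set and a closed set that are disjoint are at positive distance. [folklore] -/
theorem outer_exists_gap {A C : Set ℂ} (hA : IsCompact A) (hC : IsClosed C) (h : Disjoint A C) :
    ∃ η > 0, ∀ a ∈ A, ∀ c ∈ C, η ≤ dist a c := by
  obtain ⟨η, hη, hdisj⟩ := h.exists_thickenings hA hC
  refine ⟨η, hη, fun a ha c hc => ?_⟩
  by_contra hlt
  push Not at hlt
  have h1 : a ∈ thickening η A := mem_thickening_iff.2 ⟨a, ha, by simpa using hη⟩
  have h2 : a ∈ thickening η C := mem_thickening_iff.2 ⟨c, hc, hlt⟩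
  exact Set.disjoint_left.1 hdisj h1 h2

/-! ### The square-model chart and the geometric steps at a fixed small mesh -/

section Geometry

variable {R R' : ConformalRectangle} {F : ℂ ≃ₜ ℂ} {s η₁ η₂ δ : ℝ}

/-- The chart of a point of `R` lies in the open model square `(-1,1)²`. [folklore] -/
theorem outer_chart_mem_carrier (hF : IsSquareModel R F) {p : ℂ} (hp : p ∈ R.carrier) :
    (-1 < (F.symm p).re ∧ (F.symm p).re < 1) ∧ (-1 < (F.symm p).im ∧ (F.symm p).im < 1) := by
  rw [← hF.image_carrier] at hp
  obtain ⟨q, hq, rfl⟩ := hp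
  rw [unitSquareQuad_carrier, Complex.mem_reProdIm] at hq
  rw [Homeomorph.symm_apply_apply]
  exact ⟨hq.1, hq.2⟩

/-- Clause (W1) read backwards: a point of `R` outside the outer bracket `R'` has chart height
`|im| ≥ 1 - s`. [cite: SchrammSmirnov2011, §1.3] -/
theorem outer_abs_im_ge (hF : IsSquareModel R F)
    (hW1 : F '' {p : ℂ | |p.re| < 1 ∧ |p.im| < 1 - s} ⊆ R'.carrier) {p : ℂ} (hp : p ∈ R.carrier)
    (hp' : p ∉ R'.carrier) : 1 - s ≤ |(F.symm p).im| := by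
  by_contra hlt
  push Not at hlt
  have hre := (outer_chart_mem_carrier hF hp).1
  exact hp' (hW1 ⟨F.symm p, ⟨abs_lt.2 ⟨by linarith [hre.1], hre.2⟩, hlt⟩, F.apply_symm_apply p⟩)

/-- **(G1) No BOTTOM–TOP edge.** Two points of `R ∖ R'` at distance `≤ δ < η₂` cannot have chart
heights of opposite signs: by (W1) these heights are `≤ -(1-s)` and `≥ 1-s`, which differ by
`≥ 3/2 > s/4`. [cite: SchrammSmirnov2011, §1.3] -/
theorem outer_not_bot_top (hF : IsSquareModel R F) (hs4 : s ≤ 1 / 4)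
    (hW1 : F '' {p : ℂ | |p.re| < 1 ∧ |p.im| < 1 - s} ⊆ R'.carrier)
    (hmod : ∀ x ∈ cthickening 1 (closure R.carrier), ∀ y ∈ cthickening 1 (closure R.carrier),
      dist x y < η₂ → dist (F.symm x) (F.symm y) < s / 4)
    (hδη : δ < η₂) {p₁ p₂ : ℂ} (hp₁ : p₁ ∈ R.carrier) (hp₁' : p₁ ∉ R'.carrier)
    (him₁ : (F.symm p₁).im < 0) (hp₂ : p₂ ∈ R.carrier) (hp₂' : p₂ ∉ R'.carrier)
    (him₂ : 0 ≤ (F.symm p₂).im) (hd : dist p₁ p₂ ≤ δ) : False := by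
  have h₁ := outer_abs_im_ge hF hW1 hp₁ hp₁'
  have h₂ := outer_abs_im_ge hF hW1 hp₂ hp₂'
  rw [abs_of_neg him₁] at h₁
  rw [abs_of_nonneg him₂] at h₂
  have hch := hmod p₁ (self_subset_cthickening _ (subset_closure hp₁)) p₂
    (self_subset_cthickening _ (subset_closure hp₂)) (lt_of_le_of_lt hd hδη)
  rw [dist_eq_norm] at hch
  have him := (Complex.abs_im_le_norm _).trans_lt hch
  rw [Complex.sub_im, abs_lt] at him
  linarith [him.1]

/-- **(G2/G3) Crossing the frontier of the bracket.** If `p₁ ∈ R ∖ R'` and `p₂ ∈ R'` are within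
`δ ≤ 1`, `δ < η₂`, the segment `[p₁, p₂]` meets `frontier R'` (it enters the open set `R'`) at a point
`x` within `δ` of both ends, whose chart is `s/4`-close to that of `p₁`; so if all such charts lie in
a box `X` with `frontier R' ∩ F(X) ⊆ A` (clause (W3)), then `p₂` is within `2δ` of `A`.
[cite: SchrammSmirnov2011, §1.3] -/
theorem outer_infDist_le
    (hmod : ∀ x ∈ cthickening 1 (closure R.carrier), ∀ y ∈ cthickening 1 (closure R.carrier),
      dist x y < η₂ → dist (F.symm x) (F.symm y) < s / 4)
    (hδ : 0 ≤ δ) (hδ1 : δ ≤ 1) (hδη : δ < η₂) {X A : Set ℂ} (hW3 : frontier R'.carrier ∩ F '' X ⊆ A)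
    {p₁ p₂ : ℂ} (hp₁ : p₁ ∈ R.carrier) (hp₁' : p₁ ∉ R'.carrier) (hp₂ : p₂ ∈ R'.carrier)
    (hd : dist p₁ p₂ ≤ δ)
    (hbox : ∀ q : ℂ, |q.re - (F.symm p₁).re| < s / 4 → |q.im - (F.symm p₁).im| < s / 4 → q ∈ X) :
    infDist p₂ A ≤ 2 * δ := by
  obtain ⟨x, hxs, hxf⟩ := outer_exists_mem_frontier R'.isOpen hp₁' hp₂
  have hsum := dist_add_dist_of_mem_segment hxs
  have hx1 : dist x p₁ ≤ δ := by
    rw [dist_comm]; linarith [dist_nonneg (x := x) (y := p₂)]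
  have hx2 : dist x p₂ ≤ δ := by linarith [dist_nonneg (x := p₁) (y := x)]
  have hch := hmod x (mem_cthickening_of_dist_le x p₁ 1 _ (subset_closure hp₁) (hx1.trans hδ1)) p₁
    (self_subset_cthickening _ (subset_closure hp₁)) (lt_of_le_of_lt hx1 hδη)
  rw [dist_eq_norm] at hch
  have hre := (Complex.abs_re_le_norm _).trans_lt hch
  have him := (Complex.abs_im_le_norm _).trans_lt hch
  rw [Complex.sub_re] at hre
  rw [Complex.sub_im] at him
  have hxA : x ∈ A := hW3 ⟨hxf, F.symm x, hbox _ hre him, F.apply_symm_apply x⟩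
  calc infDist p₂ A ≤ dist p₂ x := infDist_le_dist_of_mem hxA
    _ ≤ δ := by rw [dist_comm]; exact hx2
    _ ≤ 2 * δ := by linarith

/-- **(G4) The end vertices.** A point of `R` within `2δ < min η₁ η₂` of a nonempty set
`A ⊆ closure R` that is `η₁`-far from `closure R'` (clause (W2)) and whose charts have constant
height `c` (an arc of `R`: `c = ∓1`) is outside `R'` and has chart height within `s/4` of `c`.
[cite: SchrammSmirnov2011, §1.3] -/
theorem outer_endpoint {A : Set ℂ} (hAne : A.Nonempty) (hAR : A ⊆ closure R.carrier)
    (hgap : ∀ a ∈ A, ∀ c ∈ closure R'.carrier, η₁ ≤ dist a c)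
    (hmod : ∀ x ∈ cthickening 1 (closure R.carrier), ∀ y ∈ cthickening 1 (closure R.carrier),
      dist x y < η₂ → dist (F.symm x) (F.symm y) < s / 4)
    (hδη₁ : 2 * δ < η₁) (hδη₂ : 2 * δ < η₂) {c : ℝ} (hc : ∀ a ∈ A, (F.symm a).im = c) {p : ℂ}
    (hp : p ∈ R.carrier) (hinf : infDist p A ≤ 2 * δ) :
    p ∉ R'.carrier ∧ |(F.symm p).im - c| < s / 4 := by
  refine ⟨fun hp' => ?_, ?_⟩
  · obtain ⟨a, ha, hpa⟩ := (infDist_lt_iff hAne).1 (lt_of_le_of_lt hinf hδη₁)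
    have := hgap a ha p (subset_closure hp')
    rw [dist_comm] at hpa
    linarith
  · obtain ⟨a, ha, hpa⟩ := (infDist_lt_iff hAne).1 (lt_of_le_of_lt hinf hδη₂)
    have hch := hmod p (self_subset_cthickening _ (subset_closure hp)) a
      (self_subset_cthickening _ (hAR ha)) hpa
    rw [dist_eq_norm] at hch
    have him := (Complex.abs_im_le_norm _).trans_lt hch
    rwa [Complex.sub_im, hc a ha] at him

/-- The charts of `R.arc 0` / `R.arc 2` have constant height `-1` / `1` (sides of the model square).
[folklore] -/
theorem outer_chart_arc (hF : IsSquareModel R F) :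
    (∀ a ∈ R.arc 0, (F.symm a).im = -1) ∧ (∀ a ∈ R.arc 2, (F.symm a).im = 1) := by
  constructor
  · intro a ha
    rw [← hF.image_arc 0] at ha
    obtain ⟨q, hq, rfl⟩ := ha
    rw [Homeomorph.symm_apply_apply]
    exact (SquareModel.mem_arc_zero.1 hq).1
  · intro a ha
    rw [← hF.image_arc 2] at ha
    obtain ⟨q, hq, rfl⟩ := ha
    rw [Homeomorph.symm_apply_apply]
    exact (SquareModel.mem_arc_two.1 hq).1

end Geometry

/-! ### The combinatorial core: restricted site connections and the index argument -/

/-- Prepending an open edge whose tail lies in the window to a restricted site connection.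
[folklore] -/
theorem outer_siteConnIn_cons {V : Type*} {G : SimpleGraph V} {S : Set V} {ω : SiteConfig V}
    {x y v : V} (hx : x ∈ S) (hadj : (siteOpenGraph G ω).Adj x y) (h : ω ∈ siteConnIn G S y v) :
    ω ∈ siteConnIn G S x v := by
  obtain ⟨-, hv, hy, hvS, hr⟩ := h
  have hxω : x ∈ ω := ((siteOpenGraph_adj G ω x y).1 hadj).2.1
  refine ⟨hxω, hv, hx, hvS, ?_⟩
  have hadj' : ((siteOpenGraph G ω).induce S).Adj ⟨x, hx⟩ ⟨y, hy⟩ := hadj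
  exact hadj'.reachable.trans hr

/-- **The index argument, as a structural induction on the walk.**  Window vertices are of three
types BOTTOM (`B`), IN (`I`), TOP (`T`), TOP excluding the other two; no edge joins BOTTOM to TOP
(`h1`); a BOTTOM→IN edge followed by an "open IN-path to a top exit" (`D`) yields the conclusion
`C` (`h2`); an IN→TOP edge starts such an IN-path (`h3`); IN→IN edges extend it (`h4`).  Then
every walk in the window from a BOTTOM vertex to a TOP vertex yields `C` (and from an IN vertex,
`C` or an IN-path).  Informally: `a :=` first TOP index, `b :=` last non-IN index before `a`.
[folklore] -/
theorem outer_walk_extract {V : Type*} {H : SimpleGraph V} {W : Set V} {B T I : V → Prop}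
    {C : Prop} {D : V → Prop} (hTB : ∀ x, T x → ¬ B x) (hTI : ∀ x, T x → ¬ I x)
    (htri : ∀ x ∈ W, B x ∨ I x ∨ T x)
    (h1 : ∀ x y, x ∈ W → y ∈ W → H.Adj x y → B x → T y → False)
    (h2 : ∀ x y, x ∈ W → y ∈ W → H.Adj x y → B x → I y → D y → C)
    (h3 : ∀ x y, x ∈ W → y ∈ W → H.Adj x y → I x → T y → D x)
    (h4 : ∀ x y, x ∈ W → y ∈ W → H.Adj x y → I x → I y → D y → D x)
    {x t : W} (w : (H.induce W).Walk x t) (ht : T t.1) : (B x.1 → C) ∧ (I x.1 → C ∨ D x.1) := by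
  induction w with
  | nil => exact ⟨fun hB => (hTB _ ht hB).elim, fun hI => (hTI _ ht hI).elim⟩
  | @cons a b c hadj w ih =>
    have ih' := ih ht
    have hadj' : H.Adj a.1 b.1 := hadj
    rcases htri b.1 b.2 with hb | hb | hb
    · exact ⟨fun _ => ih'.1 hb, fun _ => Or.inl (ih'.1 hb)⟩
    · refine ⟨fun ha => ?_, fun ha => ?_⟩
      · rcases ih'.2 hb with hC | hD
        · exact hC
        · exact h2 a.1 b.1 a.2 b.2 hadj' ha hb hD
      · rcases ih'.2 hb with hC | hD
        · exact Or.inl hC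
        · exact Or.inr (h4 a.1 b.1 a.2 b.2 hadj' ha hb hD)
    · exact ⟨fun ha => (h1 a.1 b.1 a.2 b.2 hadj' ha hb).elim,
        fun ha => Or.inr (h3 a.1 b.1 a.2 b.2 hadj' ha hb)⟩

/-- **Stub T2-outer — monotonicity of the crude crossing event under an outer bracket**
(registered signature, skeleton v5 of line `registered`, crux stmt-CriticalPhenomena-4559).  If
`R'` contains `F(|re|<1, |im|<1-s)`, its closure avoids `R.arc 0 ∪ R.arc 2`, and its frontier
inside the bottom/top chart boxes belongs to `R'.arc 0` / `R'.arc 2` (`0 < s ≤ 1/4`, `F` a square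
model of `R`), then for all small `δ > 0` every open `δ G_s`-path realising `cross_δ(R)` contains a
sub-path realising `cross_δ(R')`.  Schramm–Smirnov's partial order on quads, for the crude site
event; proof in the module docstring. [cite: SchrammSmirnov2011, §1.3] -/
theorem stub_crossMonoOuter :
    ∀ (R R' : Literature.Probability.RandomPlanarGeometry.ConformalRectangle) (F : ℂ ≃ₜ ℂ), Literature.Probability.Percolation.IsSquareModel R F →
      ∀ s : ℝ, 0 < s → s ≤ 1 / 4 →
        F '' {p : ℂ | |p.re| < 1 ∧ |p.im| < 1 - s} ⊆ R'.carrier →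
        Disjoint (R.arc 0 ∪ R.arc 2) (closure R'.carrier) →
        frontier R'.carrier ∩ F '' {p : ℂ | -1 - s ≤ p.re ∧ p.re ≤ 1 + s ∧ -1 - s ≤ p.im ∧ p.im ≤ -1 + 3 * s / 2} ⊆ R'.arc 0 →
        frontier R'.carrier ∩ F '' {p : ℂ | -1 - s ≤ p.re ∧ p.re ≤ 1 + s ∧ 1 - 3 * s / 2 ≤ p.im ∧ p.im ≤ 1 + s} ⊆ R'.arc 2 →
        ∀ᶠ δ : ℝ in nhdsWithin 0 (Set.Ioi 0),
          siteEmbDomainCrossing unionJackGraph unionJackEmbed R.carrier δ (R.arc 0) (R.arc 2) ⊆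
            siteEmbDomainCrossing unionJackGraph unionJackEmbed R'.carrier δ (R'.arc 0) (R'.arc 2) := by
  intro R R' F hF s hs hs4 hW1 hW2 hW3a hW3b
  -- (0) the arcs `0`, `2` of `R` are at positive distance `η₁` from `closure R'`
  obtain ⟨η₁, hη₁, hgap⟩ :=
    outer_exists_gap ((R.isCompact_arc 0).union (R.isCompact_arc 2)) isClosed_closure hW2
  -- (1) the chart `F.symm` is uniformly continuous on the compact `1`-neighbourhood of `closure R`
  have hK : IsCompact (cthickening 1 (closure R.carrier)) := R.isBounded.isCompact_closure.cthickening
  obtain ⟨η₂, hη₂, hmod⟩ := Metric.uniformContinuousOn_iff.1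
    (hK.uniformContinuousOn_of_continuous F.symm.continuous.continuousOn) (s / 4) (by positivity)
  -- (2) small meshes
  have hδ₀ : (0 : ℝ) < min (1 / 2) (min η₁ η₂ / 2) := lt_min (by norm_num) (half_pos (lt_min hη₁ hη₂))
  filter_upwards [Ioo_mem_nhdsGT hδ₀] with δ hδI
  obtain ⟨hδ, hδlt⟩ := hδI
  have hδb : δ < min η₁ η₂ / 2 := lt_of_lt_of_le hδlt (min_le_right _ _)
  have hδ1 : δ ≤ 1 := by linarith [lt_of_lt_of_le hδlt (min_le_left _ _)]
  have hδη₁ : 2 * δ < η₁ := by linarith [min_le_left η₁ η₂]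
  have hδη₂ : 2 * δ < η₂ := by linarith [min_le_right η₁ η₂]
  have hδη₂' : δ < η₂ := by linarith
  have harc := (R.arc_subset_frontier 0).trans frontier_subset_closure
  have harc' := (R.arc_subset_frontier 2).trans frontier_subset_closure
  intro ω hω
  rw [mem_siteEmbDomainCrossing_iff] at hω ⊢
  obtain ⟨u, v, hu, hv, huω, hvω, huW, hvW, hr⟩ := hω
  obtain ⟨w⟩ := hr
  -- the end vertices: `u` is BOTTOM, `v` is TOP (G4)
  obtain ⟨huR', huim⟩ := outer_endpoint ⟨_, R.pt_mem_arc_self 0⟩ harc (fun a ha => hgap a (Or.inl ha))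
    hmod hδη₁ hδη₂ (outer_chart_arc hF).1 huW hu
  obtain ⟨hvR', hvim⟩ := outer_endpoint ⟨_, R.pt_mem_arc_self 2⟩ harc' (fun a ha => hgap a (Or.inr ha))
    hmod hδη₁ hδη₂ (outer_chart_arc hF).2 hvW hv
  rw [abs_lt] at huim hvim
  -- the index argument (3), fed with (G1), (G2), (G3)
  have key := outer_walk_extract (H := siteOpenGraph unionJackGraph ω)
    (W := {y | (δ : ℂ) * unionJackEmbed y ∈ R.carrier})
    (B := fun y => (δ : ℂ) * unionJackEmbed y ∉ R'.carrier ∧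
      (F.symm ((δ : ℂ) * unionJackEmbed y)).im < 0)
    (T := fun y => (δ : ℂ) * unionJackEmbed y ∉ R'.carrier ∧
      0 ≤ (F.symm ((δ : ℂ) * unionJackEmbed y)).im)
    (I := fun y => (δ : ℂ) * unionJackEmbed y ∈ R'.carrier)
    (C := ∃ u' v', infDist ((δ : ℂ) * unionJackEmbed u') (R'.arc 0) ≤ 2 * δ ∧
      infDist ((δ : ℂ) * unionJackEmbed v') (R'.arc 2) ≤ 2 * δ ∧
      ω ∈ siteConnIn unionJackGraph {y | (δ : ℂ) * unionJackEmbed y ∈ R'.carrier} u' v')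
    (D := fun x => ∃ v', infDist ((δ : ℂ) * unionJackEmbed v') (R'.arc 2) ≤ 2 * δ ∧
      ω ∈ siteConnIn unionJackGraph {y | (δ : ℂ) * unionJackEmbed y ∈ R'.carrier} x v')
    (fun x hT hB => absurd hB.2 (not_lt.2 hT.2)) (fun x hT hI => hT.1 hI)
    (fun x _ => by
      by_cases hI : (δ : ℂ) * unionJackEmbed x ∈ R'.carrier
      · exact Or.inr (Or.inl hI)
      · by_cases him : (F.symm ((δ : ℂ) * unionJackEmbed x)).im < 0
        · exact Or.inl ⟨hI, him⟩
        · exact Or.inr (Or.inr ⟨hI, not_lt.1 him⟩))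
    (fun x y hx hy hadj hB hT =>
      outer_not_bot_top hF hs4 hW1 hmod hδη₂' hx hB.1 hB.2 hy hT.1 hT.2
        (dist_mesh_le hδ.le ((siteOpenGraph_adj _ _ _ _).1 hadj).1))
    (fun x y hx hy hadj hB hI hD => by
      obtain ⟨v', hv', hconn⟩ := hD
      have habs := outer_abs_im_ge hF hW1 hx hB.1
      rw [abs_of_neg hB.2] at habs
      have hsq := outer_chart_mem_carrier hF hx
      refine ⟨y, v', outer_infDist_le hmod hδ.le hδ1 hδη₂' hW3a hx hB.1 hI
        (dist_mesh_le hδ.le ((siteOpenGraph_adj _ _ _ _).1 hadj).1) (fun q hre him => ?_),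
        hv', hconn⟩
      rw [abs_lt] at hre him
      exact ⟨by linarith [hsq.1.1, hre.1], by linarith [hsq.1.2, hre.2],
        by linarith [hsq.2.1, him.1], by linarith [him.2]⟩)
    (fun x y hx hy hadj hI hT => by
      have habs := outer_abs_im_ge hF hW1 hy hT.1
      rw [abs_of_nonneg hT.2] at habs
      have hsq := outer_chart_mem_carrier hF hy
      refine ⟨x, outer_infDist_le hmod hδ.le hδ1 hδη₂' hW3b hy hT.1 hI
        (by rw [dist_comm]; exact dist_mesh_le hδ.le ((siteOpenGraph_adj _ _ _ _).1 hadj).1)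
        (fun q hre him => ?_), ?_⟩
      · rw [abs_lt] at hre him
        exact ⟨by linarith [hsq.1.1, hre.1], by linarith [hsq.1.2, hre.2],
          by linarith [him.1], by linarith [hsq.2.2, him.2]⟩
      · have hxω : x ∈ ω := ((siteOpenGraph_adj _ _ _ _).1 hadj).2.1
        exact ⟨hxω, hxω, hI, hI, SimpleGraph.Reachable.refl _⟩)
    (fun x y hx hy hadj hI _ hD => by
      obtain ⟨v', hv', hconn⟩ := hD
      exact ⟨v', hv', outer_siteConnIn_cons hI hadj hconn⟩)
    w ⟨hvR', by linarith [hvim.1]⟩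
  exact key.1 ⟨huR', by linarith [huim.2]⟩

end Summit.CriticalPhenomena.CardyFormulaZ2.Cruxes.MixedInterpolation.Registered

end
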